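import Mathlib
import Summits.KontsevichZagierPeriods.Zeta5Search.BigPrimeNinePoles
import Summits.KontsevichZagierPeriods.Zeta5Search.BigPrimeDivisibility
import Summits.KontsevichZagierPeriods.Zeta5Search.DualSeriesNineMinors
import HarnessLib

/-!
# `F̃₉(b)` — BIG-PRIME DIVISIBILITY of the ζ(3)-, ζ(5)- and ζ(7)-coefficients above `b₀`, with the SHARP windows
# `p ≤ d₉ + 2`, `2p ≤ d₉ + 2`, `3p ≤ d₉ + 2` (THEOREMS (W)₉∞, (U)₉∞, (S)₉∞; the `𝔽_p` half of the `k = 9` port)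

Cell `pub-zeta5` (HONEST FRAMING: systematic search; no irrationality claim unless certified).  Provenance: written
by the family-designer seat `pub-zeta5-fam-vwp-g13` (planner role, no stage permission; staged for the cell's lane),
`families/vwp/FAMILY.md` §21; `k = 9` PORT of the typer's `BigPrimeDual.lean` + `BigPrimeDivisibility.lean` (`k = 7`,
theorems (W∞)/(U∞)), whose finite-field lemmas (`prod_univ_X_add_C`, `sum_taylor_coeff_eq_zero`, `KF`, `pall`,
`pall_mul_KF`, `taylor_pall`, `one_le_padicValRat_of_eq`) are imported, not re-proved.  OUR theorems (Summit side), not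
cited facts; divisibility properties of coefficients, saying nothing about irrationality.

Let `b = (b₀; b₁,…,b₉) ∈ ℤ¹⁰` satisfy `0 ≤ 2b_j ≤ b₀` (`DualSeriesNine.InBox` and the Brown–Zudilin half-condition),
`d₉(b) = 4b₀ − Σ_j b_j` (`DualSeriesNineMinors.dNine`), and let `coeff7, coeff5, coeff3` be the canonical coefficients of
`F̃₉(b) = coeff7·ζ(7) + coeff5·ζ(5) + coeff3·ζ(3) − coeff0` (`DualSeriesNineCoefficients`).  For a prime `p ≥ b₀ + 1`:
* **(W)₉∞** `one_le_padicValRat_coeff3`: `7 ≤ p ≤ d₉(b) + 2` ⟹ `v_p(coeff3 b) ≥ 1` (for `coeff3 b ≠ 0`);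
* **(U)₉∞** `one_le_padicValRat_coeff5`: `5 ≤ p`, `2p ≤ d₉(b) + 2` ⟹ `v_p(coeff5 b) ≥ 1`;
* **(S)₉∞** `one_le_padicValRat_coeff7`: `3 ≤ p`, `3p ≤ d₉(b) + 2` ⟹ `v_p(coeff7 b) ≥ 1`.
(`Σ_j b_j ≤ 4b₀ + 2`, needed for `exists_isPFData9`, follows from the window.)  The upper ends are ONE MORE than in the
cell's typed conjectures `DualSeriesNineMinors.BigPrime9Zeta3/5/7` (gen 4: `d₉ + 1`), whose statements are therefore true
but not sharp in this range: on the 1,437 exactly computed vectors with `b₀ ≤ 120` of `HOME/pub-zeta5-fam-vwp/g4/bp9_*.json`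
the ends `d₉ + 2`, `(d₉ + 2)/2`, `(d₉ + 2)/3` are attained `313 / 107 / 49` times with `0` failures and NO prime at
`m·p = d₉ + 3` divides (`0` of `250 / 159 / 53`; `fam-vwp` gen 13, `g13/window_plus2_*.py`) — the `+2` end is the exact
analogue of the `k = 7` end `d + 1` (both are `⌊((k−1)b₀ + (k−1)/2 + 1 − Σ b_j)⌋`-type parity floors of the degree count
below).  The sharpened slot conjectures (window `+2`, primes `p ≤ b₀` down to the slot threshold included: OBSERVED-EXACT,
NOT proved below `b₀`) and their kernel-checked relation to the gen-4 statements are in `BigPrimeNineSharp.lean`.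

PROOF (Wilson duality, as at `k = 7`; `n = b₀ < p`, blocks `B_j = [b_j, n − b_j]`, nine of them, pole order `8`).
1. (`BigPrimeNinePoles.pf_coeff_eq`) `e₀(q)^8 · c_{o,q} = z_{q,7−o} ∈ ℤ`, `p ∤ e₀(q)`; `U · Σ_q c_{o,q} = Z_{7−o}`
   (`Uall_mul_sum_eq`), `p ∤ U`.
2. (`pall_pow_mul_MF`) `(∏_{s≤n}(X+s))^8 · M_b = numR · (X^p − X)^9` in `𝔽_p[X]` for the DUAL POLYNOMIAL
   `M_b = (2X+n) ∏_{s≤n}(X+s) ∏_{j<9} ∏_{u ∈ 𝔽_p∖B_j}(X+u)` (`MF`).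
3. (`zZ_cast`) at a pole: `z_{q,i} ≡ −e₀(q)^8 · [X^{i+1}] M_b(X−q)` for `i < 8`, `i + 2 ≤ p`.
4. (`natDegree_MF_le`) `deg M_b + 8n + 7 ≤ 9p + 2Σ b_j`; the power-sum lemma kills `Σ_{x∈𝔽_p} [X^{i+1}] M_b(X+x)` when
   `deg M_b < (i+1) + (i+2)(p−1)`: `i = 5` (ζ(3)) ⟸ `p ≤ d₉ + 2`; `i = 3` (ζ(5)) ⟸ `2p ≤ d₉ + 2`; `i = 1` (ζ(7)) ⟸ `3p ≤ d₉ + 2`.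
5. `U·K = Z`, `p ∣ Z`, `p ∤ U` ⟹ `v_p(K) ≥ 1`.
NOT here: primes `p ≤ b₀` (the slot / `L₂` threshold of the conjectures; at `k = 7` that is the `BigPrimeSupport` /
`BigPrimeBelowB0` / `BigPrimeWindow` chain, not ported).
-/

noncomputable section

open Finset Polynomial

namespace Summit.KontsevichZagierPeriods.Zeta5Search.BigPrimeNine

open Summit.KontsevichZagierPeriods.Zeta5Search.DualSeriesNine (InBox IsPFData9 coeff3 coeff5 coeff7 coeff3_eq
  coeff5_eq coeff7_eq exists_isPFData9)
open Summit.KontsevichZagierPeriods.Zeta5Search.DualSeriesNineMinors (dNine)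
open Summit.KontsevichZagierPeriods.Zeta5Search.BigPrime (truncInv truncInv_spec truncInv_map
  coeff_eq_of_X_pow_dvd_sub taylor_prod' taylor_X_add_C block prod_univ_X_add_C taylor_X_pow_card_sub_X
  sum_taylor_coeff_eq_zero blockF KF pall block_subset cast_injOn_range pall_mul_KF taylor_pall
  one_le_padicValRat_of_eq)

/-! ### 1. The 𝔽_p side: the dual polynomial and Wilson duality at the poles -/

section ModP

variable {p : ℕ} [hp : Fact p.Prime]

variable (p) in
/-- The DUAL POLYNOMIAL `M_b = (2X + n) · ∏_{s ≤ n} (X + s) · ∏_{j<9} K_{β_j} ∈ 𝔽_p[X]`. -/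
def MF (n : ℕ) (β : ℕ → ℕ) : (ZMod p)[X] :=
  (C 2 * X + C (n : ZMod p)) * pall p n * ∏ j ∈ range 9, KF p n (β j)

/-- **Wilson duality for the summand**: `P^8 · M_b = numR · (X^p − X)^9` in `𝔽_p[X]`. -/
theorem pall_pow_mul_MF {n : ℕ} (hn : n < p) (β : ℕ → ℕ) :
    pall p n ^ 8 * MF p n β = numR (ZMod p) n β * (X ^ p - X) ^ 9 := by
  have hkey : pall p n ^ 9 * ∏ j ∈ range 9, KF p n (β j) =
      (∏ j ∈ range 9, ∏ s ∈ range (n + 1) \ block n (β j), (X + C (s : ZMod p))) *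
        (X ^ p - X) ^ 9 := by
    rw [show pall p n ^ 9 = ∏ _j ∈ range 9, pall p n by simp, ← prod_mul_distrib,
      prod_congr rfl fun j _ => pall_mul_KF hn (β j), prod_mul_distrib]
    simp
  rw [MF, numR, show pall p n ^ 8 * ((C 2 * X + C (n : ZMod p)) * pall p n * ∏ j ∈ range 9, KF p n (β j)) =
    (C 2 * X + C (n : ZMod p)) * (pall p n ^ 9 * ∏ j ∈ range 9, KF p n (β j)) by ring, hkey]
  ring

/-- **The shifted congruence.**  At every pole `q₀ ≤ n` the integer `z_{q₀,i}` reduces modulo `p` to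
`−e₀(q₀)^8 · [X^{i+1}] M_b(X − q₀)` for `i < 8`, `i + 2 ≤ p`. -/
theorem zZ_cast {n : ℕ} (hn : n < p) (β : ℕ → ℕ) (q₀ : ℕ) (hq₀ : q₀ ≤ n)
    {i : ℕ} (hi : i < 8) (hip : i + 2 ≤ p) :
    ((zZ n β q₀ i : ℤ) : ZMod p) =
      -(((e0Z n q₀ : ℤ) : ZMod p) ^ 8) * (taylor (-((q₀ : ℕ) : ZMod p)) (MF p n β)).coeff (i + 1) := by
  set NF := taylor (-((q₀ : ℕ) : ZMod p)) (numR (ZMod p) n β) with hNF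
  set EF := ER (ZMod p) n q₀ with hEF
  set JF := truncInv EF 8 with hJF
  -- `X ∣ M_b(X − q₀)`
  have hX : (X : (ZMod p)[X]) ∣ taylor (-((q₀ : ℕ) : ZMod p)) (MF p n β) := by
    rw [MF, taylor_mul, taylor_mul, taylor_pall q₀ hq₀]
    exact ((dvd_mul_right X _).mul_left _).mul_right _
  obtain ⟨Mt, hMt⟩ := hX
  -- the shifted Wilson identity and cancellation of `X^9`
  have hshift := congrArg (taylor (-((q₀ : ℕ) : ZMod p))) (pall_pow_mul_MF hn β)
  simp only [taylor_mul, taylor_pow, taylor_pall q₀ hq₀, taylor_X_pow_card_sub_X, hMt] at hshift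
  have hXp : (X ^ p - X : (ZMod p)[X]) = X * (X ^ (p - 1) - 1) := by
    have h : (X : (ZMod p)[X]) ^ p = X * X ^ (p - 1) := by
      rw [← pow_succ', Nat.sub_add_cancel hp.out.one_le]
    rw [h]; ring
  rw [hXp] at hshift
  have hcancel : EF * Mt = NF * (X ^ (p - 1) - 1) ^ 9 := by
    have h9 : (X : (ZMod p)[X]) ^ 9 ≠ 0 := pow_ne_zero _ X_ne_zero
    apply mul_left_cancel₀ h9
    rw [hEF, ER, prod_pow, hNF]
    linear_combination hshift
  -- congruence modulo `X^{i+1}`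
  have hY : (X : (ZMod p)[X]) ^ (p - 1) ∣ (X ^ (p - 1) - 1) ^ 9 + 1 := by
    have := sub_dvd_pow_sub_pow (X ^ (p - 1) - 1 : (ZMod p)[X]) (-1) 9
    rw [sub_neg_eq_add, sub_add_cancel] at this
    refine this.trans (dvd_of_eq ?_)
    ring
  have hN : (X : (ZMod p)[X]) ^ (i + 1) ∣ X ^ (p - 1) := pow_dvd_pow X (by omega)
  have hA : (X : (ZMod p)[X]) ^ (i + 1) ∣ EF * Mt + NF := by
    rw [hcancel, show NF * (X ^ (p - 1) - 1) ^ 9 + NF = NF * ((X ^ (p - 1) - 1) ^ 9 + 1) by ring]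
    exact (hN.trans hY).mul_left _
  have hB : (X : (ZMod p)[X]) ^ (i + 1) ∣ (EF * JF - C (EF.coeff 0 ^ 8)) * Mt :=
    ((pow_dvd_pow X (by omega : i + 1 ≤ 8)).trans (truncInv_spec EF 8)).mul_right _
  have hC : (X : (ZMod p)[X]) ^ (i + 1) ∣ NF * JF - (-C (EF.coeff 0 ^ 8) * Mt) := by
    have : NF * JF - (-C (EF.coeff 0 ^ 8) * Mt) =
        (EF * Mt + NF) * JF - (EF * JF - C (EF.coeff 0 ^ 8)) * Mt := by
      ring
    rw [this]
    exact dvd_sub (hA.mul_right _) hB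
  have hcoeff := coeff_eq_of_X_pow_dvd_sub hC (Nat.lt_succ_self i)
  -- identify both sides
  have he0 : EF.coeff 0 = ((e0Z n q₀ : ℤ) : ZMod p) := by
    rw [hEF, ← ER_map (Int.castRingHom (ZMod p)), coeff_map, ER_coeff_zero]; simp
  have hL : NF * JF = (taylor (-(q₀ : ℤ)) (numR ℤ n β) * truncInv (ER ℤ n q₀) 8).map
      (Int.castRingHom (ZMod p)) := by
    rw [Polynomial.map_mul, BigPrime.map_taylor, numR_map, truncInv_map, ER_map]
    simp [hNF, hJF, hEF]
  have hMt' : Mt.coeff i = (taylor (-((q₀ : ℕ) : ZMod p)) (MF p n β)).coeff (i + 1) := by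
    rw [hMt, coeff_X_mul]
  rw [hL, coeff_map, he0, neg_mul, coeff_neg, coeff_C_mul, hMt'] at hcoeff
  have hz : ((zZ n β q₀ i : ℤ) : ZMod p) = (Int.castRingHom (ZMod p))
      ((taylor (-(q₀ : ℤ)) (numR ℤ n β) * truncInv (ER ℤ n q₀) 8).coeff i) := by
    simp [zZ]
  rw [hz, hcoeff]
  ring

/-- Off the poles `M_b` vanishes to order `9`: for `x ∉ {−s : s ≤ n}`, `X^9 ∣ M_b(X + x)`. -/
theorem X_pow_nine_dvd_taylor_MF {n : ℕ} (β : ℕ → ℕ) (x : ZMod p)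
    (hx : x ∉ (range (n + 1)).image fun q : ℕ => -((q : ℕ) : ZMod p)) :
    (X : (ZMod p)[X]) ^ 9 ∣ taylor x (MF p n β) := by
  have hK : ∀ j ∈ range 9, (X : (ZMod p)[X]) ∣ taylor x (KF p n (β j)) := by
    intro j _
    have hmem : -x ∈ univ \ blockF p n (β j) := by
      rw [mem_sdiff]
      refine ⟨mem_univ _, fun h => hx ?_⟩
      rw [blockF, mem_image] at h
      obtain ⟨s, hs, hsx⟩ := h
      exact mem_image.2 ⟨s, block_subset n (β j) hs, by rw [hsx, neg_neg]⟩
    rw [KF, taylor_prod']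
    have hfac : taylor x (X + C (-x)) = X := by rw [taylor_X_add_C, neg_add_cancel, C_0, add_zero]
    exact (dvd_of_eq hfac.symm).trans (Finset.dvd_prod_of_mem (fun u : ZMod p => taylor x (X + C u)) hmem)
  rw [MF, taylor_mul, taylor_prod']
  have h9 : (X : (ZMod p)[X]) ^ 9 = ∏ _j ∈ range 9, (X : (ZMod p)[X]) := by simp
  rw [h9]
  exact (Finset.prod_dvd_prod_of_dvd _ _ hK).mul_left _

/-- The pole sum IS the full sum over `𝔽_p` (coefficients of order `< 9`). -/
theorem sum_univ_taylor_MF_coeff {n : ℕ} (hn : n < p) (β : ℕ → ℕ) {k : ℕ} (hk : k < 9) :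
    ∑ x : ZMod p, (taylor x (MF p n β)).coeff k =
      ∑ q ∈ range (n + 1), (taylor (-((q : ℕ) : ZMod p)) (MF p n β)).coeff k := by
  have hinj : Set.InjOn (fun q : ℕ => -((q : ℕ) : ZMod p)) (range (n + 1) : Finset ℕ) := by
    intro a ha b hb hab
    exact cast_injOn_range hn ha hb (neg_inj.1 hab)
  have hzero : ∀ x ∈ (univ : Finset (ZMod p)),
      x ∉ (range (n + 1)).image (fun q : ℕ => -((q : ℕ) : ZMod p)) → (taylor x (MF p n β)).coeff k = 0 :=
    fun x _ hx => (X_pow_dvd_iff.1 (X_pow_nine_dvd_taylor_MF β x hx)) k hk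
  rw [← sum_subset (subset_univ _) hzero, sum_image hinj]

/-- Degree count: `deg M_b + 8n + 7 ≤ 9p + 2 Σ_j β_j` (for `n < p`, `2β_j ≤ n`). -/
theorem natDegree_MF_le {n : ℕ} (hn : n < p) (β : ℕ → ℕ) (hβ : ∀ j ∈ range 9, 2 * β j ≤ n) :
    (MF p n β).natDegree + 8 * n + 7 ≤ 9 * p + 2 * ∑ j ∈ range 9, β j := by
  have hlin : (C (2 : ZMod p) * X + C (n : ZMod p)).natDegree ≤ 1 := by
    refine (natDegree_add_le _ _).trans (max_le ?_ (by simp))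
    exact (natDegree_C_mul_le _ _).trans natDegree_X_le
  have hpall : (pall p n).natDegree ≤ n + 1 := by
    rw [pall]
    refine (natDegree_prod_le _ _).trans ?_
    simp only [natDegree_X_add_C, sum_const, card_range, smul_eq_mul, mul_one, le_refl]
  have hK : ∀ j ∈ range 9, (KF p n (β j)).natDegree + (n + 1) ≤ p + 2 * β j := by
    intro j hj
    have hb := hβ j hj
    have hcard : #(blockF p n (β j)) = (n - β j) + 1 - β j := by
      rw [blockF, card_image_of_injOn ((cast_injOn_range hn).mono (by exact_mod_cast block_subset n (β j))),
        block, Nat.card_Icc]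
    have hdeg : (KF p n (β j)).natDegree ≤ p - #(blockF p n (β j)) := by
      rw [KF]
      refine (natDegree_prod_le _ _).trans ?_
      simp only [natDegree_X_add_C, sum_const, card_univ_sdiff, ZMod.card, smul_eq_mul, mul_one, le_refl]
    rw [hcard] at hdeg
    omega
  have hKsum := sum_le_sum hK
  simp only [sum_add_distrib, sum_const, card_range, smul_eq_mul] at hKsum
  have hprod : (∏ j ∈ range 9, KF p n (β j)).natDegree ≤ ∑ j ∈ range 9, (KF p n (β j)).natDegree :=
    natDegree_prod_le _ _
  have hMF : (MF p n β).natDegree ≤ 1 + (n + 1) + ∑ j ∈ range 9, (KF p n (β j)).natDegree := by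
    rw [MF]
    refine (natDegree_mul_le).trans (add_le_add ((natDegree_mul_le).trans (add_le_add hlin hpall)) hprod)
  have h2 : 2 * ∑ j ∈ range 9, β j = ∑ j ∈ range 9, 2 * β j := mul_sum _ _ _
  omega

end ModP

/-! ### 2. Assembly: clearing denominators and reading the valuation -/

section Assembly

/-- `u_q = e₀(q)^8`, the denominator of the `q`-th pole. -/
def uZ (n q : ℕ) : ℤ := e0Z n q ^ 8

/-- The common denominator `U = ∏_{q ≤ n} u_q`. -/
def Uall (n : ℕ) : ℤ := ∏ q ∈ range (n + 1), uZ n q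

/-- The cleared numerator `Z_i = Σ_q z_{q,i} ∏_{s ≠ q} u_s`. -/
def Zsum (n : ℕ) (β : ℕ → ℕ) (i : ℕ) : ℤ :=
  ∑ q ∈ range (n + 1), zZ n β q i * ∏ s ∈ (range (n + 1)).erase q, uZ n s

/-- `U ≠ 0`. -/
theorem Uall_ne_zero (n : ℕ) : Uall n ≠ 0 :=
  prod_ne_zero_iff.2 fun q _ => pow_ne_zero _ (e0Z_ne_zero n q)

/-- No prime `p > n` divides the common denominator `U`. -/
theorem not_dvd_Uall {p : ℕ} (hp : p.Prime) {n : ℕ} (hn : n < p) : ¬ (p : ℤ) ∣ Uall n := by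
  have hpZ : Prime (p : ℤ) := Nat.prime_iff_prime_int.1 hp
  intro h
  obtain ⟨q, hq, hdvd⟩ := (hpZ.dvd_finsetProd_iff _).1 h
  exact not_dvd_e0Z hp hn q (by simpa [Nat.lt_succ_iff] using hq) (hpZ.dvd_of_dvd_pow hdvd)

/-- `U · Σ_q c_{o,q} = Z_{7−o}` for partial-fraction data `c`. -/
theorem Uall_mul_sum_eq (b : ℕ → ℤ) (hb : InBox b) (hhalf : ∀ j ∈ range 9, 2 * b (j + 1) ≤ b 0 + 1)
    {c : ℕ → ℕ → ℚ} (hc : IsPFData9 b c) {o : ℕ} (ho : o < 8) :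
    (Uall (b 0).toNat : ℚ) * ∑ q ∈ range ((b 0).toNat + 1), c o q =
      (Zsum (b 0).toNat (fun j => (b (j + 1)).toNat) (7 - o) : ℚ) := by
  set n := (b 0).toNat with hn
  rw [mul_sum, Zsum]
  push_cast
  refine sum_congr rfl fun q hq => ?_
  have hq' : q ≤ n := Nat.lt_succ_iff.1 (mem_range.1 hq)
  rw [Uall, ← mul_prod_erase _ _ hq]
  push_cast
  rw [← pf_coeff_eq b hb hhalf hc hq' ho, uZ]
  push_cast
  ring

/-- `Z_i ≡ −U · Σ_{x ∈ 𝔽_p} [X^{i+1}] M_b(X + x) (mod p)` for `i < 8`, `i + 2 ≤ p`. -/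
theorem Zsum_cast {p : ℕ} [hp : Fact p.Prime] {n : ℕ} (hn : n < p) (β : ℕ → ℕ)
    {i : ℕ} (hi : i < 8) (hip : i + 2 ≤ p) :
    ((Zsum n β i : ℤ) : ZMod p) =
      -((Uall n : ℤ) : ZMod p) * ∑ x : ZMod p, (taylor x (MF p n β)).coeff (i + 1) := by
  rw [sum_univ_taylor_MF_coeff hn β (by omega), Zsum, mul_sum]
  push_cast
  refine sum_congr rfl fun q hq => ?_
  have hq' : q ≤ n := Nat.lt_succ_iff.1 (mem_range.1 hq)
  rw [zZ_cast hn β q hq' hi hip, Uall, ← mul_prod_erase _ _ hq, uZ]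
  push_cast
  ring

/-- Bookkeeping: the natural-number data of an integer parameter vector with `0 ≤ 2b_j ≤ b₀`. -/
theorem polytope_data (b : ℕ → ℤ) (hb : InBox b) (h2 : ∀ i ∈ range 9, 2 * b (i + 1) ≤ b 0) :
    (b 0 : ℤ) = ((b 0).toNat : ℤ) ∧
    (∑ i ∈ range 9, b (i + 1)) = ((∑ j ∈ range 9, (b (j + 1)).toNat : ℕ) : ℤ) ∧
    (∀ j ∈ range 9, 2 * (b (j + 1)).toNat ≤ (b 0).toNat) := by
  obtain ⟨h0, hj⟩ := hb
  have e0 : (b 0 : ℤ) = ((b 0).toNat : ℤ) := (Int.toNat_of_nonneg h0).symm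
  have ej : ∀ j ∈ range 9, (b (j + 1) : ℤ) = ((b (j + 1)).toNat : ℤ) := fun j hj' =>
    (Int.toNat_of_nonneg (hj j hj').1).symm
  have hS : ∑ i ∈ range 9, b (i + 1) = ((∑ j ∈ range 9, (b (j + 1)).toNat : ℕ) : ℤ) := by
    rw [Nat.cast_sum]; exact sum_congr rfl ej
  refine ⟨e0, hS, fun j hj' => ?_⟩
  have := h2 j hj'; have := ej j hj'; omega

/-! ### 3. The theorems (W)₉∞, (U)₉∞, (S)₉∞ with the sharp windows -/

/-- (W)₉∞ in cleared form: `U · coeff3 b = Z` with `p ∤ U`, `p ∣ Z` (no non-vanishing hypothesis). -/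
theorem exists_clear_coeff3 (b : ℕ → ℤ) (p : ℕ) (hb : InBox b) (h2 : ∀ i ∈ range 9, 2 * b (i + 1) ≤ b 0)
    (hprime : p.Prime) (hp7 : 7 ≤ p) (hpb : b 0 + 1 ≤ (p : ℤ)) (hpd : (p : ℤ) ≤ dNine b + 2) :
    ∃ U Z : ℤ, ¬ (p : ℤ) ∣ U ∧ (p : ℤ) ∣ Z ∧ (U : ℚ) * coeff3 b = Z := by
  haveI : Fact p.Prime := ⟨hprime⟩
  obtain ⟨e0, hS, hβ⟩ := polytope_data b hb h2
  have hnp : (b 0).toNat < p := by omega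
  have hpd' : p + ∑ j ∈ range 9, (b (j + 1)).toNat ≤ 4 * (b 0).toNat + 2 := by
    have := hpd; rw [dNine, hS, e0] at this; omega
  have hsum : ∑ i ∈ range 9, b (i + 1) ≤ 4 * b 0 + 2 := by
    have := hpd; rw [dNine] at this; omega
  have hhalf : ∀ j ∈ range 9, 2 * b (j + 1) ≤ b 0 + 1 := fun j hj => by have := h2 j hj; omega
  obtain ⟨c, hc⟩ := exists_isPFData9 b hb hsum
  refine ⟨_, _, not_dvd_Uall hprime hnp, ?_,
    by rw [coeff3_eq hc]; exact Uall_mul_sum_eq b hb hhalf hc (by norm_num : 2 < 8)⟩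
  rw [← ZMod.intCast_zmod_eq_zero_iff_dvd, Zsum_cast hnp _ (by norm_num : 5 < 8) (by omega),
    sum_taylor_coeff_eq_zero (MF p (b 0).toNat fun j => (b (j + 1)).toNat) 6 (by omega), mul_zero]
  have := natDegree_MF_le (p := p) hnp (fun j => (b (j + 1)).toNat) hβ
  beta_reduce at this
  omega

/-- (U)₉∞ in cleared form: `U · coeff5 b = Z` with `p ∤ U`, `p ∣ Z`. -/
theorem exists_clear_coeff5 (b : ℕ → ℤ) (p : ℕ) (hb : InBox b) (h2 : ∀ i ∈ range 9, 2 * b (i + 1) ≤ b 0)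
    (hprime : p.Prime) (hp5 : 5 ≤ p) (hpb : b 0 + 1 ≤ (p : ℤ)) (hpd : 2 * (p : ℤ) ≤ dNine b + 2) :
    ∃ U Z : ℤ, ¬ (p : ℤ) ∣ U ∧ (p : ℤ) ∣ Z ∧ (U : ℚ) * coeff5 b = Z := by
  haveI : Fact p.Prime := ⟨hprime⟩
  obtain ⟨e0, hS, hβ⟩ := polytope_data b hb h2
  have hnp : (b 0).toNat < p := by omega
  have hpd' : 2 * p + ∑ j ∈ range 9, (b (j + 1)).toNat ≤ 4 * (b 0).toNat + 2 := by
    have := hpd; rw [dNine, hS, e0] at this; omega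
  have hsum : ∑ i ∈ range 9, b (i + 1) ≤ 4 * b 0 + 2 := by
    have := hpd; rw [dNine] at this; omega
  have hhalf : ∀ j ∈ range 9, 2 * b (j + 1) ≤ b 0 + 1 := fun j hj => by have := h2 j hj; omega
  obtain ⟨c, hc⟩ := exists_isPFData9 b hb hsum
  refine ⟨_, _, not_dvd_Uall hprime hnp, ?_,
    by rw [coeff5_eq hc]; exact Uall_mul_sum_eq b hb hhalf hc (by norm_num : 4 < 8)⟩
  rw [← ZMod.intCast_zmod_eq_zero_iff_dvd, Zsum_cast hnp _ (by norm_num : 3 < 8) (by omega),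
    sum_taylor_coeff_eq_zero (MF p (b 0).toNat fun j => (b (j + 1)).toNat) 4 (by omega), mul_zero]
  have := natDegree_MF_le (p := p) hnp (fun j => (b (j + 1)).toNat) hβ
  beta_reduce at this
  omega

/-- (S)₉∞ in cleared form: `U · coeff7 b = Z` with `p ∤ U`, `p ∣ Z`. -/
theorem exists_clear_coeff7 (b : ℕ → ℤ) (p : ℕ) (hb : InBox b) (h2 : ∀ i ∈ range 9, 2 * b (i + 1) ≤ b 0)
    (hprime : p.Prime) (hp3 : 3 ≤ p) (hpb : b 0 + 1 ≤ (p : ℤ)) (hpd : 3 * (p : ℤ) ≤ dNine b + 2) :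
    ∃ U Z : ℤ, ¬ (p : ℤ) ∣ U ∧ (p : ℤ) ∣ Z ∧ (U : ℚ) * coeff7 b = Z := by
  haveI : Fact p.Prime := ⟨hprime⟩
  obtain ⟨e0, hS, hβ⟩ := polytope_data b hb h2
  have hnp : (b 0).toNat < p := by omega
  have hpd' : 3 * p + ∑ j ∈ range 9, (b (j + 1)).toNat ≤ 4 * (b 0).toNat + 2 := by
    have := hpd; rw [dNine, hS, e0] at this; omega
  have hsum : ∑ i ∈ range 9, b (i + 1) ≤ 4 * b 0 + 2 := by
    have := hpd; rw [dNine] at this; omega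
  have hhalf : ∀ j ∈ range 9, 2 * b (j + 1) ≤ b 0 + 1 := fun j hj => by have := h2 j hj; omega
  obtain ⟨c, hc⟩ := exists_isPFData9 b hb hsum
  refine ⟨_, _, not_dvd_Uall hprime hnp, ?_,
    by rw [coeff7_eq hc]; exact Uall_mul_sum_eq b hb hhalf hc (by norm_num : 6 < 8)⟩
  rw [← ZMod.intCast_zmod_eq_zero_iff_dvd, Zsum_cast hnp _ (by norm_num : 1 < 8) (by omega),
    sum_taylor_coeff_eq_zero (MF p (b 0).toNat fun j => (b (j + 1)).toNat) 2 (by omega), mul_zero]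
  have := natDegree_MF_le (p := p) hnp (fun j => (b (j + 1)).toNat) hβ
  beta_reduce at this
  omega

/-- **(W)₉∞ BIG-PRIME DIVISIBILITY OF THE ζ(3)-COEFFICIENT OF `F̃₉(b)`, SHARP WINDOW.**  For `0 ≤ 2b_j ≤ b₀` and every
prime `p` with `max(7, b₀ + 1) ≤ p ≤ d₉(b) + 2 = 4b₀ + 2 − Σ_j b_j`:  `v_p(coeff3 b) ≥ 1`. -/
theorem one_le_padicValRat_coeff3 (b : ℕ → ℤ) (p : ℕ) (hb : InBox b) (h2 : ∀ i ∈ range 9, 2 * b (i + 1) ≤ b 0)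
    (hprime : p.Prime) (hp7 : 7 ≤ p) (hpb : b 0 + 1 ≤ (p : ℤ)) (hpd : (p : ℤ) ≤ dNine b + 2)
    (h3 : coeff3 b ≠ 0) : 1 ≤ padicValRat p (coeff3 b) := by
  haveI : Fact p.Prime := ⟨hprime⟩
  obtain ⟨U, Z, hU, hZ, hUK⟩ := exists_clear_coeff3 b p hb h2 hprime hp7 hpb hpd
  exact one_le_padicValRat_of_eq hUK hU hZ h3

/-- **(U)₉∞ BIG-PRIME DIVISIBILITY OF THE ζ(5)-COEFFICIENT OF `F̃₉(b)`, SHARP WINDOW.**  For `0 ≤ 2b_j ≤ b₀` and every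
prime `p ≥ max(5, b₀ + 1)` with `2p ≤ d₉(b) + 2`:  `v_p(coeff5 b) ≥ 1`. -/
theorem one_le_padicValRat_coeff5 (b : ℕ → ℤ) (p : ℕ) (hb : InBox b) (h2 : ∀ i ∈ range 9, 2 * b (i + 1) ≤ b 0)
    (hprime : p.Prime) (hp5 : 5 ≤ p) (hpb : b 0 + 1 ≤ (p : ℤ)) (hpd : 2 * (p : ℤ) ≤ dNine b + 2)
    (h5 : coeff5 b ≠ 0) : 1 ≤ padicValRat p (coeff5 b) := by
  haveI : Fact p.Prime := ⟨hprime⟩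
  obtain ⟨U, Z, hU, hZ, hUK⟩ := exists_clear_coeff5 b p hb h2 hprime hp5 hpb hpd
  exact one_le_padicValRat_of_eq hUK hU hZ h5

/-- **(S)₉∞ BIG-PRIME DIVISIBILITY OF THE ζ(7)-COEFFICIENT OF `F̃₉(b)`, SHARP WINDOW.**  For `0 ≤ 2b_j ≤ b₀` and every
prime `p ≥ max(3, b₀ + 1)` with `3p ≤ d₉(b) + 2`:  `v_p(coeff7 b) ≥ 1`. -/
theorem one_le_padicValRat_coeff7 (b : ℕ → ℤ) (p : ℕ) (hb : InBox b) (h2 : ∀ i ∈ range 9, 2 * b (i + 1) ≤ b 0)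
    (hprime : p.Prime) (hp3 : 3 ≤ p) (hpb : b 0 + 1 ≤ (p : ℤ)) (hpd : 3 * (p : ℤ) ≤ dNine b + 2)
    (h7 : coeff7 b ≠ 0) : 1 ≤ padicValRat p (coeff7 b) := by
  haveI : Fact p.Prime := ⟨hprime⟩
  obtain ⟨U, Z, hU, hZ, hUK⟩ := exists_clear_coeff7 b p hb h2 hprime hp3 hpb hpd
  exact one_le_padicValRat_of_eq hUK hU hZ h7

end Assembly

end Summit.KontsevichZagierPeriods.Zeta5Search.BigPrimeNine

end
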